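import Summits.KontsevichZagierPeriods.KontsevichZagierPeriods.Theorems.KzOnePeriodsBakerClasses
import Literature.NumberTheory.Transcendental.ManyCurvePeriodsIsotypicProofs
import Literature.NumberTheory.Transcendental.CurvePeriodsEllipticCMLoopsProofs
import Literature.NumberTheory.Transcendental.CurvePeriodsEllipticPathsHolds
import Literature.NumberTheory.EllipticCurves.NeronSigmaFunctionAnalyticProofs
import Literature.NumberTheory.EllipticCurves.WeierstrassAdditionProofs

/-!
# KontsevichZagierPeriods — class E1 per curve: the corpus's CM test curves as kernel theorems

Cell pub-kz1p (KZ 1-periods), seat b2b-kz1p-1, helper of the rung-1 item; companion of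
`KzOnePeriodsE1Curves.lean` (the NON-CM test curves, decided by a non-integral rational `j`).  Here the
CM curves of the corpus — `y² = x³ + ax` (`a = −1, −25, −1156, −36`: tests E1-01/02/03, E1-12, E1-16…22,
E1-26; `g₃ = 0`, `j = 1728`, CM by `ℤ[i]`) and `y² = x³ + 1` (E1-11/25; `g₂ = 0`, `j = 0`, CM by `ℤ[ρ]`) —
get their verdicts as kernel theorems quantified over EVERY period lattice `Λ` of the curve and EVERY
basis `(ω₁, ω₂)` of `Λ`:

* **CM decided in Lean.**  `g₃(Λ) = 0 ⇒ j(Λ) = 1728 = j(ℤ[i]) ⇒ Λ = c·ℤ[i]` (Cox Thm 10.9, tree theorem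
  `PeriodPair.exists_lattice_eq_mulLeft_of_j_eq`) `⇒ iΛ = Λ` (`I_mul_mem_lattice_iff_of_j_eq_1728`), in
  particular `Λ` has complex multiplication (`hasCM_of_g₃_eq_zero`); likewise `g₂ = 0 ⇒ ρΛ = Λ`.
* **The CM relations, from functoriality** (tests E1-01, E1-02, E1-11 — `relation`, exhibited): if
  `uΛ = Λ` then `ζ(uz; Λ) = u⁻¹ζ(z; Λ)` (`weierstrassZeta_mul_of_mul_mem_lattice_iff`), hence for the CM
  matrix `uω₁ = pω₁ + qω₂` (`q ≠ 0`) the quasi-periods satisfy `pη₁ + qη₂ = u⁻¹η₁`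
  (`quasiPeriod_relation_of_mul_mem_lattice_iff`): for `y² = x³ + ax`, `ω([i]ε₁) = iω₁` and
  `η([i]ε₁) = −iη₁` (`cm_relations_of_g₃_eq_zero`); for `y² = x³ + 1`, `ω([ρ]ε₁) = ρω₁` and
  `η([ρ]ε₁) = ρ²η₁` (`cm_relations_of_g₂_eq_zero`).  No transcendence input.
* **The CM period space** (tests E1-03, E1-11 — `no relation; dim W = 2 + 4/e = 4`): for a CM lattice
  with algebraic invariants, `1, 2πi, ω₁, η₁` are `ℚ̄`-linearly independent (Masser 1975 Thm III =
  Chudnovsky; tree theorem `masser_ellipticPeriods_cm_holds`) and `ω₂ ∈ ℚ̄ω₁`, `η₂ ∈ ℚ̄η₁ + ℚ̄ω₁`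
  (Masser Lemma 3.1; tree theorem `PeriodPair.HasCM.exists_ω₂_η₂_eq`), so the `ℚ̄`-span of
  `1, 2πi, ω₁, ω₂, η₁, η₂` has dimension EXACTLY `4` and the space of `ℚ̄`-linear relations among the six
  has dimension EXACTLY `2` (`finrank_span_periods_of_hasCM`, `finrank_relations_periods_of_hasCM`;
  HW Thm 18.9 with `n = m = 0`, `e = 2`).
* **HW Thm 13.3 (2) for CLOSED paths on a CM curve** together with closed paths on `𝔾ₘ` and `𝔸¹`
  (tree theorem `huberWustholzCurvePeriods_of_ellipticCMLoops`), in the packet model `y² = x³ + Ax + B`: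
  every vanishing `ℚ̄`-combination of such period symbols is elementary (`huberWustholzCurvePeriods_cmLoops`).

Per corpus curve (`cm_curve_1_0`, `_25_0`, `_1156_0`, `_36_0`, `_0_1`, with `exists_periodPair_*`): CM,
independence of `1, 2πi, ω₁, η₁`, the dimensions `4` and `2`, the CM relations.  Not covered (unchanged):
OPEN paths on CM curves (needs the CM analytic subgroup theorem, not in the tree), the third kind.
[cite: Masser1975, Ch. III Thm III p.36, Lemma 3.1, Lemma 3.2] [cite: HuberWustholz2022, Thm 13.3 (2) p.121; Thm 18.9 p.179]
[cite: Cox2013, Thm 10.9, §10.C] [cite: WhittakerWatson1927, §20.41]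
-/

namespace Summit.KontsevichZagierPeriods.KzOnePeriods

open Literature.NumberTheory.Transcendental Literature.NumberTheory.Transcendental.CurvePeriods
open Complex MvPolynomial

/-! ### Symmetric lattices `uΛ = Λ`: `ζ`, quasi-periods, complex multiplication -/

/-- `ζ(z; Λ)` depends only on the lattice, not on the chosen basis. [folklore] -/
theorem weierstrassZeta_congr_lattice {L L' : PeriodPair} (h : L.lattice = L'.lattice) (z : ℂ) :
    L.weierstrassZeta z = L'.weierstrassZeta z := by
  simp only [PeriodPair.weierstrassZeta]
  exact (Equiv.subtypeEquivRight (fun x => by rw [h]) : L.lattice ≃ L'.lattice).tsum_eq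
    fun l : L'.lattice ↦ (1 / (z - l) + 1 / (l : ℂ) + z / (l : ℂ) ^ 2)

/-- **`ζ(uz; Λ) = u⁻¹ ζ(z; Λ)` for a lattice with `uΛ = Λ`** (`ζ(cz; cΛ) = c⁻¹ζ(z; Λ)`, tree theorem
`PeriodPair.weierstrassZeta_mulLeft`, and `uΛ = Λ`; Cox §10.C does this for `g₂, g₃`). [folklore] -/
theorem weierstrassZeta_mul_of_mul_mem_lattice_iff (L : PeriodPair) {u : ℂ} (hu : u ≠ 0)
    (h : ∀ x, u * x ∈ L.lattice ↔ x ∈ L.lattice) (z : ℂ) :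
    L.weierstrassZeta (u * z) = u⁻¹ * L.weierstrassZeta z := by
  have h1 := L.weierstrassZeta_mulLeft hu z
  rwa [weierstrassZeta_congr_lattice (PeriodPair.mulLeft_lattice_eq_of_mul_mem_lattice_iff hu h)]
    at h1

/-- **The CM relation between the quasi-periods, from functoriality.**  If `uΛ = Λ` and
`uω₁ = pω₁ + qω₂` (`p, q ∈ ℤ`), then `pη₁ + qη₂ = u⁻¹η₁`: the quasi-period map `η(mω₁ + nω₂) = mη₁ + nη₂`
(`ζ(z + ω) = ζ(z) + η(ω)`, Whittaker–Watson §20.41, tree theorem `PeriodPair.weierstrassZeta_add_period`)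
satisfies `η(uω) = u⁻¹η(ω)` because `ζ(uz) = u⁻¹ζ(z)`.  For `u = i`: `η([i]ε₁) = −iη₁`; for `u = ρ`:
`η([ρ]ε₁) = ρ²η₁`. [cite: WhittakerWatson1927, §20.41] -/
theorem quasiPeriod_relation_of_mul_mem_lattice_iff (L : PeriodPair) {u : ℂ} (hu : u ≠ 0)
    (h : ∀ x, u * x ∈ L.lattice ↔ x ∈ L.lattice) {p q : ℤ}
    (hpq : u * L.ω₁ = p * L.ω₁ + q * L.ω₂) :
    (p : ℂ) * L.η₁ + q * L.η₂ = u⁻¹ * L.η₁ := by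
  have h1 := L.weierstrassZeta_add_period p q (u * (L.ω₁ / 2))
  have h2 := L.weierstrassZeta_add_period 1 0 (L.ω₁ / 2)
  rw [← hpq, ← mul_add, weierstrassZeta_mul_of_mul_mem_lattice_iff L hu h,
    weierstrassZeta_mul_of_mul_mem_lattice_iff L hu h] at h1
  simp only [Int.cast_one, one_mul, Int.cast_zero, zero_mul, add_zero] at h2
  rw [h2] at h1
  linear_combination -h1

/-- The second entry of a CM matrix is non-zero: if `uω₁ = pω₁ + qω₂` with `u ∉ ℤ` then `q ≠ 0`.
[folklore] -/
theorem snd_ne_zero_of_mul_ω₁_eq (L : PeriodPair) {u : ℂ} (huZ : ∀ n : ℤ, u ≠ n) {p q : ℤ}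
    (hpq : u * L.ω₁ = p * L.ω₁ + q * L.ω₂) : q ≠ 0 := by
  rintro rfl
  have hω₁ : L.ω₁ ≠ 0 := by simpa using L.indep.ne_zero 0
  have h0 : (u - p) * L.ω₁ = 0 := by
    rw [Int.cast_zero, zero_mul, add_zero] at hpq
    linear_combination hpq
  rcases mul_eq_zero.mp h0 with h | h
  · exact huZ p (by linear_combination h)
  · exact hω₁ h

/-- **The CM symbol basis.**  If `uΛ = Λ`, `u ∉ ℤ` and `uω₁ = pω₁ + qω₂`, then in the given basis
`ω₂ = ((u − p)/q)·ω₁` and `η₂ = ((u⁻¹ − p)/q)·η₁` — coefficients in `ℚ(u)`. [folklore] -/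
theorem cm_basis_relations (L : PeriodPair) {u : ℂ} (hu : u ≠ 0) (huZ : ∀ n : ℤ, u ≠ n)
    (h : ∀ x, u * x ∈ L.lattice ↔ x ∈ L.lattice) {p q : ℤ}
    (hpq : u * L.ω₁ = p * L.ω₁ + q * L.ω₂) :
    L.ω₂ = (u - p) / q * L.ω₁ ∧ L.η₂ = (u⁻¹ - p) / q * L.η₁ := by
  have hq : (q : ℂ) ≠ 0 := by exact_mod_cast snd_ne_zero_of_mul_ω₁_eq L huZ hpq
  have hη := quasiPeriod_relation_of_mul_mem_lattice_iff L hu h hpq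
  constructor
  · rw [div_mul_eq_mul_div, eq_div_iff hq]
    linear_combination -hpq
  · rw [div_mul_eq_mul_div, eq_div_iff hq]
    linear_combination hη

/-- A lattice stable under a non-integer multiplication has complex multiplication. [folklore] -/
theorem hasCM_of_mul_mem_lattice_iff (L : PeriodPair) {u : ℂ} (huZ : ∀ n : ℤ, u ≠ n)
    (h : ∀ x, u * x ∈ L.lattice ↔ x ∈ L.lattice) : L.HasCM :=
  ⟨u, huZ, fun l hl => (h l).mpr hl⟩

/-! ### `g₃ = 0 ⇒ iΛ = Λ` and `g₂ = 0 ⇒ ρΛ = Λ` -/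

/-- `g₃(Λ) = 0 ⇒ j(Λ) = 1728`. [folklore] -/
theorem j_eq_1728_of_g₃_eq_zero (L : PeriodPair) (h₃ : L.g₃ = 0) : L.j = 1728 := by
  have hΔ := L.discr_ne_zero
  rw [h₃] at hΔ
  have hg : L.g₂ ^ 3 ≠ 0 := by simpa using hΔ
  rw [PeriodPair.j_def, h₃, show L.g₂ ^ 3 - 27 * (0 : ℂ) ^ 2 = L.g₂ ^ 3 by ring, mul_div_assoc,
    div_self hg, mul_one]

/-- `g₂(Λ) = 0 ⇒ j(Λ) = 0`. [folklore] -/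
theorem j_eq_zero_of_g₂_eq_zero (L : PeriodPair) (h₂ : L.g₂ = 0) : L.j = 0 := by
  rw [PeriodPair.j_def, h₂]; simp

/-- **`j(Λ) = 1728 ⇒ iΛ = Λ`**: `j(Λ) = j(ℤi + ℤ)` (`PeriodPair.j_ofUpperHalfPlane_I`), so `Λ = c(ℤi + ℤ)`
(Cox Thm 10.9, tree theorem `PeriodPair.exists_lattice_eq_mulLeft_of_j_eq`), and `ℤi + ℤ` is stable
under `i`. [cite: Cox2013, Thm 10.9] -/
theorem I_mul_mem_lattice_iff_of_j_eq_1728 (L : PeriodPair) (hj : L.j = 1728) (x : ℂ) :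
    I * x ∈ L.lattice ↔ x ∈ L.lattice := by
  obtain ⟨c, hc, hL⟩ :=
    PeriodPair.exists_lattice_eq_mulLeft_of_j_eq (PeriodPair.j_ofUpperHalfPlane_I.trans hj.symm)
  rw [hL, PeriodPair.mem_mulLeft_lattice, PeriodPair.mem_mulLeft_lattice,
    show c⁻¹ * (I * x) = I * (c⁻¹ * x) by ring]
  exact PeriodPair.I_mul_mem_lattice_ofUpperHalfPlane_I_iff _

/-- **`j(Λ) = 0 ⇒ ρΛ = Λ`** (`ρ = e^{2πi/3}`; `j(ℤρ + ℤ) = 0`, `PeriodPair.j_ofUpperHalfPlane_ρ`).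
[cite: Cox2013, Thm 10.9] -/
theorem ρ_mul_mem_lattice_iff_of_j_eq_zero (L : PeriodPair) (hj : L.j = 0) (x : ℂ) :
    (UpperHalfPlane.ρ : ℂ) * x ∈ L.lattice ↔ x ∈ L.lattice := by
  obtain ⟨c, hc, hL⟩ :=
    PeriodPair.exists_lattice_eq_mulLeft_of_j_eq (PeriodPair.j_ofUpperHalfPlane_ρ.trans hj.symm)
  rw [hL, PeriodPair.mem_mulLeft_lattice, PeriodPair.mem_mulLeft_lattice,
    show c⁻¹ * ((UpperHalfPlane.ρ : ℂ) * x) = (UpperHalfPlane.ρ : ℂ) * (c⁻¹ * x) by ring]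
  exact PeriodPair.ρ_mul_mem_lattice_ofUpperHalfPlane_ρ_iff _

/-- `i ∉ ℤ`. [folklore] -/
theorem I_ne_intCast (n : ℤ) : I ≠ n := fun h => by simpa using congrArg Complex.im h
/-- `ρ ∉ ℤ` (`ρ ∈ ℍ`). [folklore] -/
theorem ρ_ne_intCast (n : ℤ) : (UpperHalfPlane.ρ : ℂ) ≠ n := fun h => by
  have := congrArg Complex.im h
  rw [UpperHalfPlane.coe_im, Complex.intCast_im] at this
  exact UpperHalfPlane.ρ.im_pos.ne' this

/-- `ρ⁻¹ = ρ²` (`ρ³ = 1`). [folklore] -/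
theorem ρ_inv : (UpperHalfPlane.ρ : ℂ)⁻¹ = (UpperHalfPlane.ρ : ℂ) ^ 2 :=
  inv_eq_of_mul_eq_one_right (by linear_combination PeriodPair.ρ_cube)

/-- **`g₃ = 0 ⇒ CM`** (every lattice of `y² = x³ + ax` has complex multiplication by `i`). [folklore] -/
theorem hasCM_of_g₃_eq_zero (L : PeriodPair) (h₃ : L.g₃ = 0) : L.HasCM :=
  hasCM_of_mul_mem_lattice_iff L I_ne_intCast
    (I_mul_mem_lattice_iff_of_j_eq_1728 L (j_eq_1728_of_g₃_eq_zero L h₃))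

/-- **`g₂ = 0 ⇒ CM`** (every lattice of `y² = x³ + b` has complex multiplication by `ρ`). [folklore] -/
theorem hasCM_of_g₂_eq_zero (L : PeriodPair) (h₂ : L.g₂ = 0) : L.HasCM :=
  hasCM_of_mul_mem_lattice_iff L ρ_ne_intCast
    (ρ_mul_mem_lattice_iff_of_j_eq_zero L (j_eq_zero_of_g₂_eq_zero L h₂))

/-- **Tests E1-01 + E1-02 (`relation`, exhibited) for every lattice of a curve with `g₃ = 0` and every
basis**: there are integers `p, q`, `q ≠ 0`, with `iω₁ = pω₁ + qω₂` (`ω([i]ε₁) = iω₁`: `iω₁` is a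
period) and `pη₁ + qη₂ = −iη₁` (`η([i]ε₁) = −iη₁`); in the CM symbol basis `ε₂ := [i]ε₁` these read
`ω₂ = iω₁`, `iη₁ + η₂ = 0`.  No transcendence input. [cite: Masser1975, Lemma 3.2 (κ = 0 iff g₂g₃ = 0)] -/
theorem cm_relations_of_g₃_eq_zero (L : PeriodPair) (h₃ : L.g₃ = 0) :
    ∃ p q : ℤ, q ≠ 0 ∧ I * L.ω₁ = p * L.ω₁ + q * L.ω₂ ∧ (p : ℂ) * L.η₁ + q * L.η₂ = -I * L.η₁ := by
  have hs := I_mul_mem_lattice_iff_of_j_eq_1728 L (j_eq_1728_of_g₃_eq_zero L h₃)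
  obtain ⟨p, q, hpq⟩ := PeriodPair.mem_lattice.mp ((hs _).mpr L.ω₁_mem_lattice)
  refine ⟨p, q, snd_ne_zero_of_mul_ω₁_eq L I_ne_intCast hpq.symm, hpq.symm, ?_⟩
  rw [quasiPeriod_relation_of_mul_mem_lattice_iff L I_ne_zero hs hpq.symm, Complex.inv_I]

/-- **Test E1-11 (`relation`, exhibited) for every lattice of a curve with `g₂ = 0` and every basis**:
`ρω₁ = pω₁ + qω₂` with `q ≠ 0` and `pη₁ + qη₂ = ρ²η₁`; in the CM symbol basis `ε₂ := [ρ]ε₁`: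
`ω₂ = ρω₁`, `η₂ = ρ²η₁`. [cite: Masser1975, Lemma 3.2] -/
theorem cm_relations_of_g₂_eq_zero (L : PeriodPair) (h₂ : L.g₂ = 0) :
    ∃ p q : ℤ, q ≠ 0 ∧ (UpperHalfPlane.ρ : ℂ) * L.ω₁ = p * L.ω₁ + q * L.ω₂ ∧
      (p : ℂ) * L.η₁ + q * L.η₂ = (UpperHalfPlane.ρ : ℂ) ^ 2 * L.η₁ := by
  have hs := ρ_mul_mem_lattice_iff_of_j_eq_zero L (j_eq_zero_of_g₂_eq_zero L h₂)
  obtain ⟨p, q, hpq⟩ := PeriodPair.mem_lattice.mp ((hs _).mpr L.ω₁_mem_lattice)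
  refine ⟨p, q, snd_ne_zero_of_mul_ω₁_eq L ρ_ne_intCast hpq.symm, hpq.symm, ?_⟩
  rw [quasiPeriod_relation_of_mul_mem_lattice_iff L PeriodPair.ρ_ne_zero hs hpq.symm, ρ_inv]

/-! ### The CM period space: basis `1, 2πi, ω₁, η₁`, dimension `4`, relation space `2` -/

/-- **Masser's Theorem III in Mathlib format**: for a CM lattice with algebraic invariants,
`1, 2πi, ω₁, η₁` are linearly independent over `ℚ̄ = algebraicClosure ℚ ℂ` (tree theorem
`masser_ellipticPeriods_cm_holds`). [cite: Masser1975, Ch. III Thm III p.36] -/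
theorem linearIndependent_four_of_hasCM (L : PeriodPair) (h₂ : IsAlgebraic ℚ L.g₂)
    (h₃ : IsAlgebraic ℚ L.g₃) (hCM : L.HasCM) :
    LinearIndependent (algebraicClosure ℚ ℂ) ![1, 2 * Real.pi * I, L.ω₁, L.η₁] :=
  (qbarLinearIndependent_iff _).mp (masser_ellipticPeriods_cm_holds L h₂ h₃ hCM)

/-- **The `ℚ̄`-span of the six periods of a CM curve is the span of `1, 2πi, ω₁, η₁`** (`ω₂ = κω₁`,
`η₂ = eη₁ + fω₁` with `κ, e, f ∈ ℚ̄`: Masser Lemma 3.1, tree theorem `PeriodPair.HasCM.exists_ω₂_η₂_eq`).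
[cite: Masser1975, Lemma 3.1] [cite: HuberWustholz2022, Prop 16.5 (2) p.161] -/
theorem span_periods_eq_of_hasCM (L : PeriodPair) (h₂ : IsAlgebraic ℚ L.g₂)
    (h₃ : IsAlgebraic ℚ L.g₃) (hCM : L.HasCM) :
    Submodule.span (algebraicClosure ℚ ℂ) (Set.range ![1, 2 * Real.pi * I, L.ω₁, L.ω₂, L.η₁, L.η₂])
      = Submodule.span (algebraicClosure ℚ ℂ) (Set.range ![1, 2 * Real.pi * I, L.ω₁, L.η₁]) := by
  set K := algebraicClosure ℚ ℂ with hK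
  have hmul : ∀ (S : Submodule K ℂ) (c : ℂ), c ∈ K → ∀ z ∈ S, c * z ∈ S := fun S c hc z hz => by
    simpa [IntermediateField.smul_def] using S.smul_mem (⟨c, hc⟩ : K) hz
  obtain ⟨κ, e, f, hκ, he, hf, hω₂, hη₂⟩ := hCM.exists_ω₂_η₂_eq h₂ h₃
  apply le_antisymm
  · set U := Submodule.span K (Set.range ![1, 2 * Real.pi * I, L.ω₁, L.η₁]) with hU
    have u0 : (1 : ℂ) ∈ U := Submodule.subset_span ⟨0, by simp⟩
    have u1 : (2 * Real.pi * I : ℂ) ∈ U := Submodule.subset_span ⟨1, by simp⟩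
    have u2 : L.ω₁ ∈ U := Submodule.subset_span ⟨2, by simp⟩
    have u3 : L.η₁ ∈ U := Submodule.subset_span ⟨3, by simp⟩
    have hω₂U : L.ω₂ ∈ U := by
      rw [hω₂]; exact hmul U κ (mem_algebraicClosure_iff.mpr hκ) _ u2
    have hη₂U : L.η₂ ∈ U := by
      rw [hη₂]
      exact add_mem (hmul U e (mem_algebraicClosure_iff.mpr he) _ u3)
        (hmul U f (mem_algebraicClosure_iff.mpr hf) _ u2)
    rw [Submodule.span_le, Set.range_subset_iff]
    intro i
    fin_cases i <;> simp [u0, u1, u2, u3, hω₂U, hη₂U]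
  · set V := Submodule.span K (Set.range ![1, 2 * Real.pi * I, L.ω₁, L.ω₂, L.η₁, L.η₂]) with hV
    have v0 : (1 : ℂ) ∈ V := Submodule.subset_span ⟨0, by simp⟩
    have v1 : (2 * Real.pi * I : ℂ) ∈ V := Submodule.subset_span ⟨1, by simp⟩
    have v2 : L.ω₁ ∈ V := Submodule.subset_span ⟨2, by simp⟩
    have v4 : L.η₁ ∈ V := Submodule.subset_span ⟨4, by simp⟩
    rw [Submodule.span_le, Set.range_subset_iff]
    intro i
    fin_cases i <;> simp [v0, v1, v2, v4]

/-- **CM period space, dimension EXACTLY `4`** (tests E1-03 / E1-11: "dim W = 2 + 4/e = 4, e = 2";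
HW Thm 18.9 with `n = m = 0`): the `ℚ̄`-span of `1, 2πi, ω₁, ω₂, η₁, η₂` of a CM lattice with algebraic
invariants has dimension `4`, with basis `1, 2πi, ω₁, η₁`.
[cite: Masser1975, Ch. III Thm III p.36] [cite: HuberWustholz2022, Thm 18.9 p.179] -/
theorem finrank_span_periods_of_hasCM (L : PeriodPair) (h₂ : IsAlgebraic ℚ L.g₂)
    (h₃ : IsAlgebraic ℚ L.g₃) (hCM : L.HasCM) :
    Module.finrank (algebraicClosure ℚ ℂ) (Submodule.span (algebraicClosure ℚ ℂ)
      (Set.range ![1, 2 * Real.pi * I, L.ω₁, L.ω₂, L.η₁, L.η₂])) = 4 := by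
  rw [span_periods_eq_of_hasCM L h₂ h₃ hCM,
    finrank_span_eq_card (linearIndependent_four_of_hasCM L h₂ h₃ hCM), Fintype.card_fin]

/-- **CM relation space, dimension EXACTLY `2`**: the kernel of the evaluation map `ℚ̄⁶ → ℂ`,
`β ↦ β₁ + β₂·2πi + β₃ω₁ + β₄ω₂ + β₅η₁ + β₆η₂`, has dimension `2` (spanned by the two CM relations
`ω₂ = κω₁`, `η₂ = eη₁ + fω₁`; rank–nullity with `finrank_span_periods_of_hasCM`).
[cite: Masser1975, Ch. III Thm III, Lemma 3.1] [cite: HuberWustholz2022, Thm 18.9 p.179] -/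
theorem finrank_relations_periods_of_hasCM (L : PeriodPair) (h₂ : IsAlgebraic ℚ L.g₂)
    (h₃ : IsAlgebraic ℚ L.g₃) (hCM : L.HasCM) :
    Module.finrank (algebraicClosure ℚ ℂ) (LinearMap.ker (Fintype.linearCombination (algebraicClosure ℚ ℂ)
      ![1, 2 * Real.pi * I, L.ω₁, L.ω₂, L.η₁, L.η₂])) = 2 := by
  have h := LinearMap.finrank_range_add_finrank_ker
    (Fintype.linearCombination (algebraicClosure ℚ ℂ) ![1, 2 * Real.pi * I, L.ω₁, L.ω₂, L.η₁, L.η₂])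
  rw [Fintype.range_linearCombination, finrank_span_periods_of_hasCM L h₂ h₃ hCM,
    Module.finrank_fin_fun] at h
  omega

/-- **HW Thm 13.3 (2) for CLOSED paths on a CM curve `y² = x³ + Ax + B` (`A, B ∈ ℚ̄`), with closed
paths on `𝔾ₘ` and any paths on `𝔸¹` — kernel theorem** (tree theorem
`huberWustholzCurvePeriods_of_ellipticCMLoops`, `E_L = E_{A,B}` by `Ell.curve_eq_weierCurve`): every
vanishing `ℚ̄`-linear combination of such period symbols is a `ℚ̄`-combination of the elementary relations.
[cite: HuberWustholz2022, Thm 13.3 (2) p.121, §13.2] [cite: Masser1975, Ch. III Thm III] -/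
theorem huberWustholzCurvePeriods_cmLoops {A B : ℂ} (L : PeriodPair) (hL₂ : L.g₂ = -4 * A)
    (hL₃ : L.g₃ = -4 * B) (hA : IsAlgebraic ℚ A) (hB : IsAlgebraic ℚ B) (hCM : L.HasCM)
    (c : PeriodSymbol →₀ ℂ) (hc : ∀ s, IsAlgebraic ℚ (c s))
    (hsupp : ∀ s ∈ c.support,
      (s.Z = weierCurve A B ∧ s.γ.toFun 1 = s.γ.toFun 0) ∨
        (s.Z = (⟨2, 1, ![X 0 * X 1 - 1]⟩ : CurveData) ∧ s.γ.toFun 1 = s.γ.toFun 0) ∨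
        s.Z = CurveData.affineLine)
    (h0 : evalCombination c = 0) :
    ∃ (k : ℕ) (ρ : Fin k → (PeriodSymbol →₀ ℂ)) (a : Fin k → ℂ),
      (∀ l, IsElementaryRelation (ρ l)) ∧ (∀ l, IsAlgebraic ℚ (a l)) ∧ c = ∑ l, a l • ρ l := by
  have h₂ : IsAlgebraic ℚ L.g₂ := by rw [hL₂]; exact ((isAlgebraic_int 4).neg).mul hA
  have h₃ : IsAlgebraic ℚ L.g₃ := by rw [hL₃]; exact ((isAlgebraic_int 4).neg).mul hB
  have hE : Ell.curve L = weierCurve A B := Ell.curve_eq_weierCurve hL₂ hL₃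
  refine huberWustholzCurvePeriods_of_ellipticCMLoops L h₂ h₃ hCM c hc (fun s hs => ?_) h0
  rw [hE]
  exact hsupp s hs

/-! ### The corpus shape `g₂ = −4a`, `g₃ = −4b` with `b = 0` (CM by `i`) or `a = 0` (CM by `ρ`) -/

/-- **Every lattice of `y² = x³ + ax` (`a ∈ ℤ`; `g₂ = −4a`, `g₃ = 0`), in every basis**: CM (by `i`);
`1, 2πi, ω₁, η₁` `ℚ̄`-linearly independent; `dim_ℚ̄ ⟨1, 2πi, ω₁, ω₂, η₁, η₂⟩ = 4` and relation space of
dimension `2`; the CM relations `iω₁ = pω₁ + qω₂`, `pη₁ + qη₂ = −iη₁` (`q ≠ 0`).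
[cite: Masser1975, Ch. III Thm III, Lemma 3.1, Lemma 3.2] [cite: HuberWustholz2022, Thm 18.9 p.179] -/
theorem cm_package_of_b_eq_zero (L : PeriodPair) (a : ℤ) (h₂ : L.g₂ = -4 * (a : ℂ))
    (h₃ : L.g₃ = -4 * ((0 : ℤ) : ℂ)) :
    L.HasCM ∧ QbarLinearIndependent ![1, 2 * Real.pi * I, L.ω₁, L.η₁] ∧
      Module.finrank (algebraicClosure ℚ ℂ) (Submodule.span (algebraicClosure ℚ ℂ)
        (Set.range ![1, 2 * Real.pi * I, L.ω₁, L.ω₂, L.η₁, L.η₂])) = 4 ∧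
      Module.finrank (algebraicClosure ℚ ℂ) (LinearMap.ker (Fintype.linearCombination
        (algebraicClosure ℚ ℂ) ![1, 2 * Real.pi * I, L.ω₁, L.ω₂, L.η₁, L.η₂])) = 2 ∧
      ∃ p q : ℤ, q ≠ 0 ∧ I * L.ω₁ = p * L.ω₁ + q * L.ω₂ ∧
        (p : ℂ) * L.η₁ + q * L.η₂ = -I * L.η₁ := by
  have h₃' : L.g₃ = 0 := by rw [h₃]; simp
  have hg₂ : IsAlgebraic ℚ L.g₂ := by rw [h₂]; exact ((isAlgebraic_int 4).neg).mul (isAlgebraic_int a)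
  have hg₃ : IsAlgebraic ℚ L.g₃ := by rw [h₃']; exact isAlgebraic_zero
  have hCM := hasCM_of_g₃_eq_zero L h₃'
  exact ⟨hCM, masser_ellipticPeriods_cm_holds L hg₂ hg₃ hCM, finrank_span_periods_of_hasCM L hg₂ hg₃ hCM,
    finrank_relations_periods_of_hasCM L hg₂ hg₃ hCM, cm_relations_of_g₃_eq_zero L h₃'⟩

/-- **Every lattice of `y² = x³ + b` (`b ∈ ℤ`; `g₂ = 0`, `g₃ = −4b`), in every basis**: CM (by `ρ`);
`1, 2πi, ω₁, η₁` independent over `ℚ̄`; dimensions `4` and `2`; the CM relations `ρω₁ = pω₁ + qω₂`,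
`pη₁ + qη₂ = ρ²η₁` (`q ≠ 0`). [cite: Masser1975, Ch. III Thm III, Lemma 3.1, Lemma 3.2] [cite: HuberWustholz2022, Thm 18.9 p.179] -/
theorem cm_package_of_a_eq_zero (L : PeriodPair) (b : ℤ) (h₂ : L.g₂ = -4 * ((0 : ℤ) : ℂ))
    (h₃ : L.g₃ = -4 * (b : ℂ)) :
    L.HasCM ∧ QbarLinearIndependent ![1, 2 * Real.pi * I, L.ω₁, L.η₁] ∧
      Module.finrank (algebraicClosure ℚ ℂ) (Submodule.span (algebraicClosure ℚ ℂ)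
        (Set.range ![1, 2 * Real.pi * I, L.ω₁, L.ω₂, L.η₁, L.η₂])) = 4 ∧
      Module.finrank (algebraicClosure ℚ ℂ) (LinearMap.ker (Fintype.linearCombination
        (algebraicClosure ℚ ℂ) ![1, 2 * Real.pi * I, L.ω₁, L.ω₂, L.η₁, L.η₂])) = 2 ∧
      ∃ p q : ℤ, q ≠ 0 ∧ (UpperHalfPlane.ρ : ℂ) * L.ω₁ = p * L.ω₁ + q * L.ω₂ ∧
        (p : ℂ) * L.η₁ + q * L.η₂ = (UpperHalfPlane.ρ : ℂ) ^ 2 * L.η₁ := by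
  have h₂' : L.g₂ = 0 := by rw [h₂]; simp
  have hg₂ : IsAlgebraic ℚ L.g₂ := by rw [h₂']; exact isAlgebraic_zero
  have hg₃ : IsAlgebraic ℚ L.g₃ := by rw [h₃]; exact ((isAlgebraic_int 4).neg).mul (isAlgebraic_int b)
  have hCM := hasCM_of_g₂_eq_zero L h₂'
  exact ⟨hCM, masser_ellipticPeriods_cm_holds L hg₂ hg₃ hCM, finrank_span_periods_of_hasCM L hg₂ hg₃ hCM,
    finrank_relations_periods_of_hasCM L hg₂ hg₃ hCM, cm_relations_of_g₂_eq_zero L h₂'⟩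

/-- **HW Thm 13.3 (2), closed paths, for every CM corpus curve `y² = x³ + ax`** (`a ∈ ℤ`): period
symbols on `E_{a,0}` and `𝔾ₘ` with closed paths, and on `𝔸¹`. [cite: HuberWustholz2022, Thm 13.3 (2) p.121] -/
theorem huberWustholzCurvePeriods_cmLoops_of_b_eq_zero (L : PeriodPair) (a : ℤ)
    (h₂ : L.g₂ = -4 * (a : ℂ)) (h₃ : L.g₃ = -4 * ((0 : ℤ) : ℂ))
    (c : PeriodSymbol →₀ ℂ) (hc : ∀ s, IsAlgebraic ℚ (c s))
    (hsupp : ∀ s ∈ c.support,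
      (s.Z = weierCurve (a : ℂ) ((0 : ℤ) : ℂ) ∧ s.γ.toFun 1 = s.γ.toFun 0) ∨
        (s.Z = (⟨2, 1, ![X 0 * X 1 - 1]⟩ : CurveData) ∧ s.γ.toFun 1 = s.γ.toFun 0) ∨
        s.Z = CurveData.affineLine)
    (h0 : evalCombination c = 0) :
    ∃ (k : ℕ) (ρ : Fin k → (PeriodSymbol →₀ ℂ)) (a : Fin k → ℂ),
      (∀ l, IsElementaryRelation (ρ l)) ∧ (∀ l, IsAlgebraic ℚ (a l)) ∧ c = ∑ l, a l • ρ l :=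
  huberWustholzCurvePeriods_cmLoops L h₂ h₃ (isAlgebraic_int _) (isAlgebraic_int _)
    (cm_package_of_b_eq_zero L a h₂ h₃).1 c hc hsupp h0

/-- A period lattice of `y² = x³ + ax` exists for `a ≠ 0` (Uniformization Theorem, tree theorem
`PeriodPair.uniformization_holds`; `Δ = −64a³ ≠ 0`). [cite: SilvermanAEC2009, Thm VI.5.1] -/
theorem exists_periodPair_of_b_eq_zero (a : ℤ) (ha : a ≠ 0) :
    ∃ L : PeriodPair, L.g₂ = -4 * (a : ℂ) ∧ L.g₃ = -4 * ((0 : ℤ) : ℂ) := by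
  refine PeriodPair.uniformization_holds _ _ ?_
  have ha' : (a : ℂ) ≠ 0 := by exact_mod_cast ha
  rw [show (-4 * (a : ℂ)) ^ 3 - 27 * (-4 * ((0 : ℤ) : ℂ)) ^ 2 = -64 * (a : ℂ) ^ 3 by push_cast; ring]
  exact mul_ne_zero (by norm_num) (pow_ne_zero 3 ha')

/-! ### The CM curves of the corpus -/

/-- **`y² = x³ − x`** (Gauss's lemniscate curve; tests E1-01, E1-02, E1-03), every lattice, every basis:
CM; `1, 2πi, ω₁, η₁` independent over `ℚ̄` (E1-03: `no relation`, `dim W = 4`); dimensions `4` / `2`;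
the CM relations `ω([i]ε₁) = iω₁`, `η([i]ε₁) = −iη₁` (E1-01, E1-02).  The curves `y² = x³ − 25x` (E1-12),
`y² = x³ − 1156x` (E1-16…22), `y² = x³ − 36x` (E1-26) are `cm_package_of_b_eq_zero L (−25 | −1156 | −36)`.
[cite: Masser1975, Ch. III Thm III] [cite: HuberWustholz2022, Thm 18.9 p.179] -/
theorem cm_curve_1_0 (L : PeriodPair) (h₂ : L.g₂ = -4 * ((-1 : ℤ) : ℂ))
    (h₃ : L.g₃ = -4 * ((0 : ℤ) : ℂ)) :
    L.HasCM ∧ QbarLinearIndependent ![1, 2 * Real.pi * I, L.ω₁, L.η₁] ∧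
      Module.finrank (algebraicClosure ℚ ℂ) (Submodule.span (algebraicClosure ℚ ℂ)
        (Set.range ![1, 2 * Real.pi * I, L.ω₁, L.ω₂, L.η₁, L.η₂])) = 4 ∧
      Module.finrank (algebraicClosure ℚ ℂ) (LinearMap.ker (Fintype.linearCombination
        (algebraicClosure ℚ ℂ) ![1, 2 * Real.pi * I, L.ω₁, L.ω₂, L.η₁, L.η₂])) = 2 ∧
      ∃ p q : ℤ, q ≠ 0 ∧ I * L.ω₁ = p * L.ω₁ + q * L.ω₂ ∧
        (p : ℂ) * L.η₁ + q * L.η₂ = -I * L.η₁ :=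
  cm_package_of_b_eq_zero L (-1) h₂ h₃

/-- **`y² = x³ + 1`** (equianharmonic; tests E1-11, E1-25), every lattice, every basis: CM; `1, 2πi, ω₁, η₁`
independent over `ℚ̄` (`dim ⟨1, 2πi, ω, η⟩ = 4`); dimensions `4` / `2`; the CM relations
`ω([ρ]ε₁) = ρω₁`, `η([ρ]ε₁) = ρ²η₁` (E1-11: `ω₂ = ζ₃ω₁`, `η₂ = ζ₃²η₁`).
[cite: Masser1975, Ch. III Thm III] [cite: HuberWustholz2022, Thm 18.9 p.179] -/
theorem cm_curve_0_1 (L : PeriodPair) (h₂ : L.g₂ = -4 * ((0 : ℤ) : ℂ))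
    (h₃ : L.g₃ = -4 * ((1 : ℤ) : ℂ)) :
    L.HasCM ∧ QbarLinearIndependent ![1, 2 * Real.pi * I, L.ω₁, L.η₁] ∧
      Module.finrank (algebraicClosure ℚ ℂ) (Submodule.span (algebraicClosure ℚ ℂ)
        (Set.range ![1, 2 * Real.pi * I, L.ω₁, L.ω₂, L.η₁, L.η₂])) = 4 ∧
      Module.finrank (algebraicClosure ℚ ℂ) (LinearMap.ker (Fintype.linearCombination
        (algebraicClosure ℚ ℂ) ![1, 2 * Real.pi * I, L.ω₁, L.ω₂, L.η₁, L.η₂])) = 2 ∧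
      ∃ p q : ℤ, q ≠ 0 ∧ (UpperHalfPlane.ρ : ℂ) * L.ω₁ = p * L.ω₁ + q * L.ω₂ ∧
        (p : ℂ) * L.η₁ + q * L.η₂ = (UpperHalfPlane.ρ : ℂ) ^ 2 * L.η₁ :=
  cm_package_of_a_eq_zero L 1 h₂ h₃

/-- Period lattices of the five CM corpus curves `y² = x³ − x, x³ − 25x, x³ − 1156x, x³ − 36x, x³ + 1`
exist (Uniformization Theorem, tree theorem `PeriodPair.uniformization_holds`), so the statements above
are not vacuous. [cite: SilvermanAEC2009, Thm VI.5.1] -/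
theorem exists_periodPair_cm_curves :
    (∃ L : PeriodPair, L.g₂ = -4 * ((-1 : ℤ) : ℂ) ∧ L.g₃ = -4 * ((0 : ℤ) : ℂ)) ∧
    (∃ L : PeriodPair, L.g₂ = -4 * ((-25 : ℤ) : ℂ) ∧ L.g₃ = -4 * ((0 : ℤ) : ℂ)) ∧
    (∃ L : PeriodPair, L.g₂ = -4 * ((-1156 : ℤ) : ℂ) ∧ L.g₃ = -4 * ((0 : ℤ) : ℂ)) ∧
    (∃ L : PeriodPair, L.g₂ = -4 * ((-36 : ℤ) : ℂ) ∧ L.g₃ = -4 * ((0 : ℤ) : ℂ)) ∧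
    (∃ L : PeriodPair, L.g₂ = -4 * ((0 : ℤ) : ℂ) ∧ L.g₃ = -4 * ((1 : ℤ) : ℂ)) :=
  ⟨exists_periodPair_of_b_eq_zero (-1) (by norm_num), exists_periodPair_of_b_eq_zero (-25) (by norm_num),
    exists_periodPair_of_b_eq_zero (-1156) (by norm_num), exists_periodPair_of_b_eq_zero (-36) (by norm_num),
    PeriodPair.uniformization_holds _ _ (by push_cast; norm_num)⟩

end Summit.KontsevichZagierPeriods.KzOnePeriods
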